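import Literature.Probability.RandomPlanarGeometry.LoewnerGrowth
import HarnessLib

/-!
# Arc confinement of a Loewner trace: the deterministic core

Topic `Probability/RandomPlanarGeometry`; theorems only. Deterministic half of the statement
"the SLE_κ trace, `4 < κ < 8`, has no sub-path confined to a simple arc" (used for the
regularity of the chordal SLE₆ family in the refutation of crux `stmt-CriticalPhenomena-0698`:
no traced straight segments, no traced circle arcs).

Let the chain of the continuous driving function `W` be generated by the curve `γ`
(`Loewner.IsGeneratedByCurve`), so that the hulls grow strictly (`Loewner.hull_ssubset_hull`).

* `IsGeneratedByCurve.hull_eq_of_image_Icc_subset`, `IsGeneratedByCurve.not_image_Icc_subset` —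
  **no stalling**: the piece `γ[a, b]`, `a < b`, is never contained in the past `γ[0, a]`
  (else `ℍ ∖ γ[0, b] = ℍ ∖ γ[0, a]` and the hulls at `a` and `b` coincide).
* **`IsGeneratedByCurve.mem_image_Icc_of_injOn`** — the core: if a continuous real function `ρ`
  is injective on `γ[t₁, t₂]` (equivalently, `γ[t₁, t₂]` is a point or a simple arc, on which `ρ`
  is a parameter), `t₁ < τ < t₂`, and right after `τ` the curve keeps touching its past
  `γ[0, τ]` at points other than `γ τ` (times `uₙ → τ`, `uₙ ∈ (τ, t₂]`), then `γ τ ∈ γ[0, t₁]`.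
  Mechanism: by no-stalling the past piece `γ[t₁, τ]` lies on ONE side of `γ τ` along the arc and
  the future `γ[τ, t₂]` on the other side (never re-entering the past piece), so the touched past
  points are points of `γ[0, t₁]` accumulating at `γ τ`, and `γ[0, t₁]` is closed.
  For the SLE trace the touching is supplied by the strong Markov property at the hitting time
  `τ` of a small ball first entered during `(t₁, t₂)` (boundary touching of SLE_κ, `κ > 4`), and the
  conclusion contradicts the definition of that hitting time.

References: G. F. Lawler, *Conformally Invariant Processes in the Plane* (2005), §4.1 (hulls
generated by a curve); S. Rohde, O. Schramm, *Basic properties of SLE*, Ann. of Math. 161 (2005), §1.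
-/

noncomputable section

open Set Filter Topology

open scoped NNReal

namespace Literature.Probability.RandomPlanarGeometry

namespace Loewner

variable {W : ℝ≥0 → ℝ} {γ : ℝ≥0 → ℂ}

/-- If the piece `γ[a, b]` lies in the past `γ[0, a]`, the hulls at `a` and `b` agree. [folklore] -/
theorem IsGeneratedByCurve.hull_eq_of_image_Icc_subset (h : IsGeneratedByCurve W γ) {a b : ℝ≥0}
    (hab : a ≤ b) (hsub : γ '' Icc a b ⊆ γ '' Icc 0 a) : hull W b = hull W a := by
  have himg : γ '' Icc 0 b = γ '' Icc 0 a := by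
    refine Subset.antisymm ?_ (image_mono (Icc_subset_Icc_right hab))
    rw [← Icc_union_Icc_eq_Icc (zero_le (a := a)) hab, image_union]
    exact union_subset Subset.rfl hsub
  rw [h.2.2.2 b, h.2.2.2 a, himg]

/-- **No stalling**: for `a < b` the piece `γ[a, b]` is not contained in the past `γ[0, a]`
(strict growth of the hulls). [folklore] -/
theorem IsGeneratedByCurve.not_image_Icc_subset (hW : Continuous W) (h : IsGeneratedByCurve W γ)
    {a b : ℝ≥0} (hab : a < b) : ¬ γ '' Icc a b ⊆ γ '' Icc 0 a := fun hsub ↦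
  (hull_ssubset_hull hW hab).ne (h.hull_eq_of_image_Icc_subset hab.le hsub).symm

/-- A right neighbourhood inside `(τ, t₂)`: if a property holds near `τ` then it holds on some
`[τ, σ]` with `τ < σ < t₂`. [folklore] -/
theorem exists_Icc_subset_of_mem_nhds {τ t₂ : ℝ≥0} (hτ : τ < t₂) {S : Set ℝ≥0} (hS : S ∈ 𝓝 τ) :
    ∃ σ, τ < σ ∧ σ < t₂ ∧ Icc τ σ ⊆ S := by
  obtain ⟨σ₁, hσ₁, hsub⟩ := exists_Ico_subset_of_mem_nhds hS ⟨t₂, hτ⟩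
  obtain ⟨σ, hσ, hσ'⟩ := exists_between (lt_min hσ₁ hτ)
  exact ⟨σ, hσ, hσ'.trans_le (min_le_right _ _),
    fun s hs ↦ hsub ⟨hs.1, hs.2.trans_lt (hσ'.trans_le (min_le_left _ _))⟩⟩

section Core

variable (hW : Continuous W) (h : IsGeneratedByCurve W γ) {t₁ τ t₂ : ℝ≥0} (h₁ : t₁ < τ) (h₂ : τ < t₂)
  {ρ : ℂ → ℝ} (hρ : Continuous ρ) (hinj : InjOn ρ (γ '' Icc t₁ t₂))

include hinj in
/-- Injectivity of the parameter: equal `ρ`-values on `γ[t₁, t₂]` mean equal points. [folklore] -/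
theorem eq_of_param_eq {s v : ℝ≥0} (hs : s ∈ Icc t₁ t₂) (hv : v ∈ Icc t₁ t₂)
    (he : ρ (γ s) = ρ (γ v)) : γ s = γ v :=
  hinj (mem_image_of_mem _ hs) (mem_image_of_mem _ hv) he

include hW h h₁ h₂ hρ hinj in
/-- The past piece `γ[t₁, τ]` does not straddle `γ τ` along the arc: it cannot take `ρ`-values
both above and below `ρ (γ τ)` (else the future right after `τ` stays inside the past piece).
[folklore] -/
theorem IsGeneratedByCurve.not_straddle :
    ¬ ((∃ s ∈ Icc t₁ τ, ρ (γ τ) < ρ (γ s)) ∧ (∃ s' ∈ Icc t₁ τ, ρ (γ s') < ρ (γ τ))) := by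
  rintro ⟨⟨s, hs, hlt⟩, ⟨s', hs', hlt'⟩⟩
  have hx : Continuous fun u ↦ ρ (γ u) := hρ.comp h.1
  have hnhds : {u | ρ (γ u) ∈ Ioo (ρ (γ s')) (ρ (γ s))} ∈ 𝓝 τ :=
    hx.continuousAt.preimage_mem_nhds (isOpen_Ioo.mem_nhds ⟨hlt', hlt⟩)
  obtain ⟨σ, hτσ, hσt₂, hsub⟩ := exists_Icc_subset_of_mem_nhds h₂ hnhds
  refine h.not_image_Icc_subset hW hτσ ?_
  rintro _ ⟨σ', hσ', rfl⟩
  have hval : ρ (γ σ') ∈ Ioo (ρ (γ s')) (ρ (γ s)) := hsub hσ'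
  -- the value is attained by the past piece
  have hIVT := intermediate_value_uIcc (a := s') (b := s) (f := fun u ↦ ρ (γ u)) hx.continuousOn
  have hmem : ρ (γ σ') ∈ uIcc (ρ (γ s')) (ρ (γ s)) := by
    rw [uIcc_of_le (hlt'.trans hlt).le]
    exact ⟨hval.1.le, hval.2.le⟩
  obtain ⟨v, hv, hveq⟩ := hIVT hmem
  have hvI : v ∈ Icc t₁ τ := by
    rcases le_total s' s with hss | hss
    · rw [uIcc_of_le hss] at hv; exact ⟨hs'.1.trans hv.1, hv.2.trans hs.2⟩
    · rw [uIcc_of_ge hss] at hv; exact ⟨hs.1.trans hv.1, hv.2.trans hs'.2⟩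
  have heq : γ v = γ σ' := eq_of_param_eq hinj ⟨hvI.1, hvI.2.trans h₂.le⟩
    ⟨h₁.le.trans hσ'.1, hσ'.2.trans hσt₂.le⟩ hveq
  exact ⟨v, ⟨zero_le, hvI.2⟩, heq⟩

include hW h h₁ h₂ hρ hinj in
/-- **The core, past below.** If the past piece has `ρ`-values `≤ ρ (γ τ)` and the curve touches
its past `γ[0, τ]` at points `≠ γ τ` at times `uₙ ↓ τ`, then `γ τ ∈ γ[0, t₁]`. [folklore] -/
theorem IsGeneratedByCurve.mem_image_Icc_of_injOn_of_le
    (hbelow : ∀ s ∈ Icc t₁ τ, ρ (γ s) ≤ ρ (γ τ)) {u : ℕ → ℝ≥0} (hu : Tendsto u atTop (𝓝 τ))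
    (huI : ∀ n, u n ∈ Ioc τ t₂) (hpast : ∀ n, γ (u n) ∈ γ '' Icc 0 τ)
    (hne : ∀ n, γ (u n) ≠ γ τ) : γ τ ∈ γ '' Icc 0 t₁ := by
  have hx : Continuous fun u ↦ ρ (γ u) := hρ.comp h.1
  have hτI : τ ∈ Icc t₁ t₂ := ⟨h₁.le, h₂.le⟩
  -- the past piece is not reduced to `γ τ`
  obtain ⟨s₀, hs₀, hs₀lt⟩ : ∃ s₀ ∈ Icc t₁ τ, ρ (γ s₀) < ρ (γ τ) := by
    by_contra hcon
    push Not at hcon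
    refine h.not_image_Icc_subset hW h₁ ?_
    rintro _ ⟨s, hs, rfl⟩
    have hseq : ρ (γ s) = ρ (γ τ) := le_antisymm (hbelow s hs) (hcon s hs)
    have h1eq : ρ (γ t₁) = ρ (γ τ) :=
      le_antisymm (hbelow t₁ ⟨le_rfl, h₁.le⟩) (hcon t₁ ⟨le_rfl, h₁.le⟩)
    have hst : γ s = γ t₁ := eq_of_param_eq hinj ⟨hs.1, hs.2.trans h₂.le⟩ ⟨le_rfl, (h₁.trans h₂).le⟩
      (hseq.trans h1eq.symm)
    exact ⟨t₁, ⟨zero_le, le_rfl⟩, hst.symm⟩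
  -- Step D: the future does not go below `ρ (γ τ)`
  have hfut : ∀ v ∈ Icc τ t₂, ρ (γ τ) ≤ ρ (γ v) := by
    by_contra hcon
    push Not at hcon
    -- a time strictly inside `(τ, t₂)` with a smaller value
    obtain ⟨v, hv, hvlt⟩ : ∃ v ∈ Ioo τ t₂, ρ (γ v) < ρ (γ τ) := by
      obtain ⟨v, hv, hvlt⟩ := hcon
      rcases hv.2.lt_or_eq with hvt | hvt
      · exact ⟨v, ⟨hv.1.lt_of_ne (by rintro rfl; exact hvlt.false), hvt⟩, hvlt⟩
      · -- `v = t₂`: move slightly to the left by continuity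
        rw [hvt] at hvlt
        have hnhds : {w | ρ (γ w) < ρ (γ τ)} ∈ 𝓝 t₂ :=
          hx.continuousAt.preimage_mem_nhds (isOpen_Iio.mem_nhds hvlt)
        obtain ⟨l, hl, hsub⟩ := exists_Ioc_subset_of_mem_nhds hnhds ⟨τ, h₂⟩
        obtain ⟨w, hw, hw'⟩ := exists_between (max_lt hl h₂)
        exact ⟨w, ⟨(le_max_right _ _).trans_lt hw, hw'⟩,
          hsub ⟨(le_max_left _ _).trans_lt hw, hw'.le⟩⟩
    -- an intermediate level strictly between `ρ (γ s₀)` and `ρ (γ τ)`, attained after `τ`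
    set y := max (ρ (γ v)) ((ρ (γ s₀) + ρ (γ τ)) / 2) with hy
    have hyτ : y < ρ (γ τ) := max_lt hvlt (by linarith)
    have hys₀ : ρ (γ s₀) < y := lt_of_lt_of_le (by linarith) (le_max_right _ _)
    obtain ⟨w, hw, hweq⟩ : ∃ w ∈ Icc τ v, ρ (γ w) = y :=
      intermediate_value_Icc' hv.1.le hx.continuousOn ⟨le_max_left _ _, hyτ.le⟩
    have hτw : τ < w := hw.1.lt_of_ne (by rintro rfl; exact hyτ.ne' hweq)
    -- an interval of such times right after `w`
    have hO : IsOpen ({z | ρ (γ z) ∈ Ioo (ρ (γ s₀)) (ρ (γ τ))} ∩ Ioo τ t₂) :=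
      (isOpen_Ioo.preimage hx).inter isOpen_Ioo
    have hwO : w ∈ {z | ρ (γ z) ∈ Ioo (ρ (γ s₀)) (ρ (γ τ))} ∩ Ioo τ t₂ :=
      ⟨by rw [mem_setOf_eq, hweq]; exact ⟨hys₀, hyτ⟩, hτw, hw.2.trans_lt hv.2⟩
    obtain ⟨σ, hwσ, -, hsub⟩ := exists_Icc_subset_of_mem_nhds (hw.2.trans_lt hv.2) (hO.mem_nhds hwO)
    refine h.not_image_Icc_subset hW hwσ ?_
    rintro _ ⟨z, hz, rfl⟩
    obtain ⟨hzval, hzI⟩ := hsub hz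
    -- the value is attained by the past piece `γ[s₀, τ]`
    obtain ⟨r, hr, hreq⟩ : ∃ r ∈ Icc s₀ τ, ρ (γ r) = ρ (γ z) :=
      intermediate_value_Icc hs₀.2 hx.continuousOn ⟨hzval.1.le, hzval.2.le⟩
    have hrz : γ r = γ z := eq_of_param_eq hinj ⟨hs₀.1.trans hr.1, hr.2.trans h₂.le⟩
      ⟨h₁.le.trans hzI.1.le, hzI.2.le⟩ hreq
    exact ⟨r, ⟨zero_le, hr.2.trans hτw.le⟩, hrz⟩
  -- Step E: the touched points are in `γ[0, t₁]`
  have hmem : ∀ n, γ (u n) ∈ γ '' Icc 0 t₁ := by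
    intro n
    obtain ⟨s, hs, hse⟩ := hpast n
    by_cases hst : t₁ ≤ s
    · exfalso
      have hle1 : ρ (γ s) ≤ ρ (γ τ) := hbelow s ⟨hst, hs.2⟩
      have hle2 : ρ (γ τ) ≤ ρ (γ (u n)) := hfut (u n) ⟨(huI n).1.le, (huI n).2⟩
      have heq : ρ (γ (u n)) = ρ (γ τ) := by rw [← hse] at hle2 ⊢; exact le_antisymm hle1 hle2
      exact hne n (eq_of_param_eq hinj ⟨h₁.le.trans (huI n).1.le, (huI n).2⟩ hτI heq)
    · push Not at hst
      exact ⟨s, ⟨zero_le, hst.le⟩, hse⟩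
  have hclosed : IsClosed (γ '' Icc 0 t₁) := (isCompact_Icc.image h.1).isClosed
  exact hclosed.mem_of_tendsto ((h.1.tendsto τ).comp hu) (Eventually.of_forall hmem)

end Core

/-- **Arc confinement, deterministic core.** Let the chain of the continuous `W` be generated by
`γ`, let `ρ : ℂ → ℝ` be continuous and injective on `γ[t₁, t₂]` (`t₁ < τ < t₂`), and let the curve
touch its past `γ[0, τ]` at points `≠ γ τ` at times `uₙ → τ`, `uₙ ∈ (τ, t₂]`. Then `γ τ ∈ γ[0, t₁]`.
[folklore] -/
theorem IsGeneratedByCurve.mem_image_Icc_of_injOn (hW : Continuous W) (h : IsGeneratedByCurve W γ)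
    {t₁ τ t₂ : ℝ≥0} (h₁ : t₁ < τ) (h₂ : τ < t₂) {ρ : ℂ → ℝ} (hρ : Continuous ρ)
    (hinj : InjOn ρ (γ '' Icc t₁ t₂)) {u : ℕ → ℝ≥0} (hu : Tendsto u atTop (𝓝 τ))
    (huI : ∀ n, u n ∈ Ioc τ t₂) (hpast : ∀ n, γ (u n) ∈ γ '' Icc 0 τ)
    (hne : ∀ n, γ (u n) ≠ γ τ) : γ τ ∈ γ '' Icc 0 t₁ := by
  by_cases hbelow : ∀ s ∈ Icc t₁ τ, ρ (γ s) ≤ ρ (γ τ)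
  · exact h.mem_image_Icc_of_injOn_of_le hW h₁ h₂ hρ hinj hbelow hu huI hpast hne
  · -- past above: apply the previous case to `-ρ`
    push Not at hbelow
    have habove : ∀ s ∈ Icc t₁ τ, ρ (γ τ) ≤ ρ (γ s) := by
      intro s hs
      by_contra hlt
      push Not at hlt
      exact h.not_straddle hW h₁ h₂ hρ hinj ⟨hbelow, ⟨s, hs, hlt⟩⟩
    have hinj' : InjOn (fun z ↦ -ρ z) (γ '' Icc t₁ t₂) := fun a ha b hb hab ↦
      hinj ha hb (neg_injective hab)
    exact h.mem_image_Icc_of_injOn_of_le hW h₁ h₂ hρ.neg hinj'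
      (fun s hs ↦ neg_le_neg (habove s hs)) hu huI hpast hne

end Loewner

end Literature.Probability.RandomPlanarGeometry

end
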